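import Mathlib
import HarnessLib
import Literature.MathematicalPhysics.StatisticalMechanics.AbkmPackageSlots
import Literature.MathematicalPhysics.StatisticalMechanics.AbkmPackageSlotF4Phi22
import Literature.MathematicalPhysics.StatisticalMechanics.AbkmTwoKernelHolderPair
import Literature.MathematicalPhysics.StatisticalMechanics.FluctuationKernelComparisonLineSecondNearTorusFRD

/-!
# [ABKM19] Lemma 8.4 (`ℓ = 2`) along a LINE for EVERY package: the `N`-free second-order pair-property supplier near a
# connected `(k+1)`-polymer `U` (per-block constant `κ_p ≤ (1+ε)A_𝒫'`, polynomial in `|U|_{k+1}` explicit)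

Second-order companion of `AbkmPackagePairSuppliers.exists_pairSuppliers` (near-`U` branch).  The kernel-level four-kernel
second-difference bound of `K_{k+1}` (`RenormalisationMapFreeHtKernelSecondDiffWeak`, block B4 of the line `banach_two_kernel` of the
child `TwoKernelSkBound` of the cruxes `HypACumulant` / `HypALocalTwoPoint`, route
`Summits/HubbardSuperconductivity/…/Theses/ComplexGFFStiffness`) consumes `‖(R_a − R_b − R_c + R_e)F‖_{k:k+1,Y} ≤ b·ℓ_n(U)·κ_p^{|Y|_k}`
on the `k`-polymers `Y ⊆ U + [−(2^d−1)L^k, …]^d`.  Along a line `q, q+y, q+y+y` of the tuning ball this is discharged from the fields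
of a package `P : PackageData d` ONCE, with `N`-free data: the Hölder pair of `exists_holderPair_weightIntConstRho_le_one_add_mul`
(`κ_p ≤ (1+ε)A_𝒫'`, any `ε > 0`) and the near-`U` line supplier `tayNormLE_fluct_lineSecondDiff_near_of_torusFRD`, with
`|2y|₁e^{2K|2y|₁} ≤ 2|y|₁e^{4K}`, `C_ℓ(2)`'s shell constant replaced by its positive part, and the square root of the diameter
polynomial squared (`√s ≤ s` for `s ≥ 1`):

* **`PackageData.exists_lineSecondPairSupplier`** — `≤ b·(ℓ_n·|y|₁²·3^{d+1}(2(L|U|_{k+1} + 2(2^{d+1}+R) + 2p_Φ + 1))^d)·κ_p^{|Y|_k}`.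

Everything is proved; no named fact.  Nothing about superconductivity in the Hubbard model.

## References
* S. Adams, S. Buchholz, R. Kotecký, S. Müller, arXiv:1910.13564, Lemma 8.4, Lemma 12.6 (12.53) [AdamsBuchholzKoteckyMuller2019].
* S. Buchholz, J. Funct. Anal. 275 (2018), Thm 4.5 [Buchholz2016].
-/

noncomputable section

namespace Literature.MathematicalPhysics.StatisticalMechanics.GradientRG

open scoped BigOperators Classical
open Finset
open Literature.MathematicalPhysics.StatisticalMechanics.TorusPolymer (IsPolymer numBlocks thicken blocks)
open Literature.Barriers.CriticalPhenomena.LongRangePhi4.Polymer (IsConn)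

variable {d : ℕ}

namespace PackageData

set_option maxHeartbeats 800000 in
/-- **The line second-order pair-property supplier of a package near `U`, `N`-free** (module docstring): for every `ε > 0`
there are `N`-free `ℓ_n, κ_p ≥ 0` with `κ_p ≤ (1+ε)·A_𝒫'` such that for every height `N`, every line `q, q+y, q+y+y` in the tuning
ball, every `k + 1 ≤ N`, every connected `(k+1)`-polymer `U`, every `k`-polymer `Y ⊆ U + [−(2^d−1)L^k, …]^d` and every
`T_k^{Y*}`-local `C^{r₀}` functional `F` with `‖F‖_{k,Y} ≤ b`:
`‖(R_{q+y+y} − R_{q+y} − R_{q+y} + R_q)F‖_{k:k+1,Y} ≤ b·(ℓ_n|y|₁²·3^{d+1}(2(L|U|_{k+1} + 2(2^{d+1}+R) + 2p_Φ + 1))^d)·κ_p^{|Y|_k}`.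
[cite: AdamsBuchholzKoteckyMuller2019, Lemma 8.4 / Lemma 12.6 (12.53)] -/
theorem exists_lineSecondPairSupplier (P : PackageData d) [Fact (0 < P.h)] [Fact (0 < P.L)] {ε : ℝ} (hε : 0 < ε) :
    ∃ ℓn κp : ℝ, 0 ≤ ℓn ∧ 0 ≤ κp ∧ κp ≤ (1 + ε) * P.A𝒫' ∧
      ∀ (N M : ℕ) [NeZero M] (Q : PackageAt P N M) (q y : Matrix (Fin d) (Fin d) ℝ),
        P.InBall q → P.InBall (q + y) → P.InBall (q + y + y) → ∀ k, k + 1 ≤ N →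
        ∀ U : Finset (Fin d → ZMod M), IsPolymer (P.L ^ (k + 1)) U → IsConn U →
          ∀ X : Finset (Fin d → ZMod M), IsPolymer (P.L ^ k) X → X ⊆ thicken ((2 ^ d - 1) * P.L ^ k) U →
          ∀ (F : ((Fin d → ZMod M) → ℝ) → ℂ) (b : ℝ), 0 ≤ b → ContDiff ℝ P.r₀ F →
            IsGaugeLocal (Q.normParams.gauge k X) F →
            TayNormLE (Q.normParams.gauge k X) P.r₀
              ((abkmWeightData P.L N P.Mord P.R P.θbar (schedDelta P.δ₀ P.δ₁ N) fun j => Q.𝒞 1 j).weight k X) F b →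
            TayNormLE (Q.normParams.gauge k X) P.r₀
              ((abkmWeightData P.L N P.Mord P.R P.θbar (schedDelta P.δ₀ P.δ₁ N) fun j => Q.𝒞 1 j).midWeight k X)
              (fluct (Q.kernels (q + y + y) (k + 1)) F - fluct (Q.kernels (q + y) (k + 1)) F -
                fluct (Q.kernels (q + y) (k + 1)) F + fluct (Q.kernels q (k + 1)) F)
              (b * (ℓn * esum y * esum y *
                ((3 : ℝ) ^ (d + 1) *
                  ((2 * (P.L * numBlocks (P.L ^ (k + 1)) U + 2 * (2 ^ (d + 1) + P.R) + 2 * P.pT + 1) : ℕ) : ℝ) ^ d)) *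
                κp ^ numBlocks (P.L ^ k) X) := by
  -- the Hölder pair: `κp = A𝒫(ρ'')^{1/p} ≤ (1+ε) A𝒫'`
  set c₁ := traceConst d P.Mord P.R P.lam (derivSum d P.n fun θ' _ => P.Cα θ' 0) with hc₁
  have hc₁0 : 0 ≤ c₁ := traceConst_nonneg d P.Mord P.R P.hlam.le (derivSum_nonneg d P.n _)
  obtain ⟨p, qH, ρ'', hpq, hρ''0, hρ''bar, -, hpρ, hWε⟩ :=
    exists_holderPair_weightIntConstRho_le_one_add_mul (c₁ := c₁) P.hθbar P.hθ0 P.hθ hc₁0 hε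
  set κp := weightIntConstRho P.θbar ρ'' c₁ ^ (1 / p) with hκpdef
  have hW0 : 0 ≤ weightIntConstRho P.θbar ρ'' c₁ :=
    zero_le_one.trans (one_le_weightIntConstRho P.hθbar hρ''0 hρ''bar hc₁0)
  have hκp0 : 0 ≤ κp := Real.rpow_nonneg hW0 _
  have hκpε : κp ≤ (1 + ε) * P.A𝒫' := by rw [← P.hA𝒫']; exact hWε
  have hqH0 : 0 ≤ qH := le_of_lt (lt_trans one_pos hpq.symm.lt)
  -- the `N`-free constants
  have hL0 : (0 : ℝ) < P.L := by exact_mod_cast P.hLodd.pos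
  set K := shellRatioConst P.c (P.Cℓ 1) (P.L : ℝ) d P.ñ with hK
  have hK0 : 0 ≤ K := shellRatioConst_nonneg P.hc P.hC1 hL0.le d P.ñ
  set K₂ := max (shellRatioConst P.c (P.Cℓ 2) (P.L : ℝ) d P.ñ) 0 with hK₂
  have hK₂0 : 0 ≤ K₂ := le_max_right _ _
  set ℓn := ((P.r₀ : ℝ) + 1) * (27 * qH ^ 2 * (2 * Real.exp (4 * K) * K) ^ 2) +
    2 * (((P.r₀ : ℝ) + 1) * (8 * qH * (2⁻¹ * K₂))) with hℓn
  have hℓn0 : 0 ≤ ℓn := by positivity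
  refine ⟨ℓn, κp, hℓn0, hκp0, hκpε, ?_⟩
  intro N M _ Q q y hq hqy hqyy k hk U hU hUc X hX hXU F b hb hFd hFloc hF
  have hC2 : 0 ≤ P.Cℓ 2 := cl_nonneg_of_packageAt P Q (by norm_num)
  have hK₂le : shellRatioConst P.c (P.Cℓ 2) (P.L : ℝ) d P.ñ ≤ K₂ := le_max_left _ _
  -- the three points of the line
  have hy : y.IsSymm := by
    have h := hqy.1.sub hq.1
    rwa [add_sub_cancel_left] at h
  have e2 : q + y + y = q + (2 : ℝ) • y := by rw [two_smul, add_assoc]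
  have hq2yT : ∑ i, ∑ j, |(q + (2 : ℝ) • y) i j| ≤ P.T₀ := by rw [← e2]; exact hqyy.2
  -- `|y|₁ ≤ 1`, the entry sum of `(q + 2y) − q = 2y`
  set t := esum y with htdef
  have ht0 : 0 ≤ t := entrySum_nonneg _
  have ht1 : t ≤ 1 := by
    have h1 : esum y ≤ esum (q + y) + esum q := by
      have e : y = (q + y) - q := by abel
      unfold esum
      rw [← Finset.sum_add_distrib]
      refine Finset.sum_le_sum fun i _ => ?_
      rw [← Finset.sum_add_distrib]
      refine Finset.sum_le_sum fun j _ => ?_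
      conv_lhs => rw [e]
      rw [Matrix.sub_apply]
      exact abs_sub _ _
    have h2 : esum (q + y) ≤ P.T₀ := hqy.2
    have h3 : esum q ≤ P.T₀ := hq.2
    linarith [P.hT₀]
  have hT : ∑ i, ∑ j, |((q + (2 : ℝ) • y) - q) i j| = 2 * t := by
    rw [add_sub_cancel_left, htdef]
    unfold esum
    rw [Finset.mul_sum]
    refine Finset.sum_congr rfl fun i _ => ?_
    rw [Finset.mul_sum]
    refine Finset.sum_congr rfl fun j _ => ?_
    rw [Matrix.smul_apply, smul_eq_mul, abs_mul, abs_of_nonneg (by norm_num : (0 : ℝ) ≤ 2)]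
  -- the near-`U` line supplier
  have hnear := tayNormLE_fluct_lineSecondDiff_near_of_torusFRD (pT := P.pT) (r₀ := P.r₀) (h := P.h) (A := P.A) P.hd
    P.hMord P.hMR P.hLodd P.hL Q.hM P.hθbar P.hlam P.hn P.hn2 P.hnñ P.hgap P.hc P.hC1 hC2 Q.hallA Q.hB hk P.hθ0 P.hθ P.hT₀
    P.hKT₀ hq.1 hy hq.2 hqy.2 hq2yT hpq hρ''0 hρ''bar hpρ hUc hX hXU hb hFd hFloc hF
  rw [hT, ← e2] at hnear
  refine hnear.mono ?_ (fun φ => ((abkmWeightData P.L N P.Mord P.R P.θbar (schedDelta P.δ₀ P.δ₁ N)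
    fun j => Q.𝒞 1 j).midWeight_pos k X φ).le)
  -- compare the constants
  set S := Real.sqrt ((3 : ℝ) ^ (d + 1) *
    ((2 * (P.L * numBlocks (P.L ^ (k + 1)) U + 2 * (2 ^ (d + 1) + P.R) + 2 * P.pT + 1) : ℕ) : ℝ) ^ d) with hS
  have hS0 : 0 ≤ S := Real.sqrt_nonneg _
  have hSsq : S ^ 2 = (3 : ℝ) ^ (d + 1) *
      ((2 * (P.L * numBlocks (P.L ^ (k + 1)) U + 2 * (2 ^ (d + 1) + P.R) + 2 * P.pT + 1) : ℕ) : ℝ) ^ d :=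
    Real.sq_sqrt (by positivity)
  have hS1 : 1 ≤ S := by
    rw [hS]
    apply Real.le_sqrt_of_sq_le
    have h3 : (1 : ℝ) ≤ (3 : ℝ) ^ (d + 1) := one_le_pow₀ (by norm_num)
    have hD : (1 : ℝ) ≤ ((2 * (P.L * numBlocks (P.L ^ (k + 1)) U + 2 * (2 ^ (d + 1) + P.R) + 2 * P.pT + 1) : ℕ) : ℝ) ^ d :=
      one_le_pow₀ (by exact_mod_cast (show 1 ≤ 2 * (P.L * numBlocks (P.L ^ (k + 1)) U + 2 * (2 ^ (d + 1) + P.R) + 2 * P.pT + 1) by omega))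
    nlinarith
  have hSle : S ≤ S ^ 2 := by nlinarith
  have hwpos : 0 ≤ (weightIntConstRho P.θbar ρ'' c₁ ^ (1 / p)) ^ numBlocks (P.L ^ k) X := pow_nonneg hκp0 _
  refine mul_le_mul_of_nonneg_right (mul_le_mul_of_nonneg_left ?_ hb) hwpos
  -- first summand: `(S · (2t e^{2K·2t} K))² ≤ (2 e^{4K} K)² S² t²`
  have hexp : Real.exp (2 * K * (2 * t)) ≤ Real.exp (4 * K) := Real.exp_le_exp.2 (by nlinarith)
  have hin1 : 2 * t * Real.exp (2 * K * (2 * t)) * K ≤ t * (2 * Real.exp (4 * K) * K) := by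
    have := mul_le_mul_of_nonneg_left hexp (by positivity : (0 : ℝ) ≤ 2 * t * K)
    nlinarith [this]
  have hin1' : 0 ≤ 2 * t * Real.exp (2 * K * (2 * t)) * K := by positivity
  have h1 : ((P.r₀ : ℝ) + 1) * (27 * qH ^ 2 * (S * (2 * t * Real.exp (2 * K * (2 * t)) * K)) ^ 2) ≤
      ((P.r₀ : ℝ) + 1) * (27 * qH ^ 2 * (2 * Real.exp (4 * K) * K) ^ 2) * t * t * S ^ 2 := by
    have hsq : (S * (2 * t * Real.exp (2 * K * (2 * t)) * K)) ^ 2 ≤ (S * (t * (2 * Real.exp (4 * K) * K))) ^ 2 :=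
      pow_le_pow_left₀ (mul_nonneg hS0 hin1') (mul_le_mul_of_nonneg_left hin1 hS0) 2
    have hr0 : (0 : ℝ) ≤ ((P.r₀ : ℝ) + 1) * (27 * qH ^ 2) := by positivity
    calc ((P.r₀ : ℝ) + 1) * (27 * qH ^ 2 * (S * (2 * t * Real.exp (2 * K * (2 * t)) * K)) ^ 2)
        = ((P.r₀ : ℝ) + 1) * (27 * qH ^ 2) * (S * (2 * t * Real.exp (2 * K * (2 * t)) * K)) ^ 2 := by ring
      _ ≤ ((P.r₀ : ℝ) + 1) * (27 * qH ^ 2) * (S * (t * (2 * Real.exp (4 * K) * K))) ^ 2 :=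
          mul_le_mul_of_nonneg_left hsq hr0
      _ = ((P.r₀ : ℝ) + 1) * (27 * qH ^ 2 * (2 * Real.exp (4 * K) * K) ^ 2) * t * t * S ^ 2 := by ring
  -- second summand: `S · (½ t² K₂) ≤ ½ K₂' t² S²`
  have h2 : 2 * (((P.r₀ : ℝ) + 1) * (8 * qH * (S * (2⁻¹ * t ^ 2 * shellRatioConst P.c (P.Cℓ 2) (P.L : ℝ) d P.ñ)))) ≤
      2 * (((P.r₀ : ℝ) + 1) * (8 * qH * (2⁻¹ * K₂))) * t * t * S ^ 2 := by
    have hin : S * (2⁻¹ * t ^ 2 * shellRatioConst P.c (P.Cℓ 2) (P.L : ℝ) d P.ñ) ≤ S ^ 2 * (2⁻¹ * t ^ 2 * K₂) :=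
      mul_le_mul hSle (mul_le_mul_of_nonneg_left hK₂le (by positivity)) (by
        have := shellRatioConst_nonneg P.hc hC2 hL0.le d P.ñ; positivity) (by positivity)
    have hr0 : (0 : ℝ) ≤ 2 * (((P.r₀ : ℝ) + 1) * (8 * qH)) := by positivity
    calc 2 * (((P.r₀ : ℝ) + 1) * (8 * qH * (S * (2⁻¹ * t ^ 2 * shellRatioConst P.c (P.Cℓ 2) (P.L : ℝ) d P.ñ))))
        = 2 * (((P.r₀ : ℝ) + 1) * (8 * qH)) * (S * (2⁻¹ * t ^ 2 * shellRatioConst P.c (P.Cℓ 2) (P.L : ℝ) d P.ñ)) := by ring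
      _ ≤ 2 * (((P.r₀ : ℝ) + 1) * (8 * qH)) * (S ^ 2 * (2⁻¹ * t ^ 2 * K₂)) := mul_le_mul_of_nonneg_left hin hr0
      _ = 2 * (((P.r₀ : ℝ) + 1) * (8 * qH * (2⁻¹ * K₂))) * t * t * S ^ 2 := by ring
  have hsum := add_le_add h1 h2
  rw [htdef] at hsum
  calc ((P.r₀ : ℝ) + 1) * (27 * qH ^ 2 * (S * (2 * esum y * Real.exp (2 * K * (2 * esum y)) * K)) ^ 2) +
        2 * (((P.r₀ : ℝ) + 1) * (8 * qH * (S * (2⁻¹ * (∑ i, ∑ j, |y i j|) ^ 2 *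
          shellRatioConst P.c (P.Cℓ 2) (P.L : ℝ) d P.ñ))))
      ≤ ((P.r₀ : ℝ) + 1) * (27 * qH ^ 2 * (2 * Real.exp (4 * K) * K) ^ 2) * esum y * esum y * S ^ 2 +
          2 * (((P.r₀ : ℝ) + 1) * (8 * qH * (2⁻¹ * K₂))) * esum y * esum y * S ^ 2 := hsum
    _ = ℓn * esum y * esum y * ((3 : ℝ) ^ (d + 1) *
          ((2 * (P.L * numBlocks (P.L ^ (k + 1)) U + 2 * (2 ^ (d + 1) + P.R) + 2 * P.pT + 1) : ℕ) : ℝ) ^ d) := by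
        rw [← hSsq, hℓn]; ring

end PackageData

end Literature.MathematicalPhysics.StatisticalMechanics.GradientRG

end
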